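import Mathlib
import Literature.MathematicalPhysics.QuantumFieldTheory.Luscher2010.TrivializingMaps
import Literature.MathematicalPhysics.QuantumFieldTheory.Luscher2010.FlowActionSeries
import Literature.MathematicalPhysics.QuantumFieldTheory.Luscher2010.EulerStepProofs
import Literature.MathematicalPhysics.QuantumFieldTheory.SUNBakryEmeryPoincare
import Summits.Ventures.LatticeQCDFlow.TrivializingMaps.TruncationDefect
import Summits.Ventures.LatticeQCDFlow.TrivializingMaps.HaarByPartsZeroModes
import Summits.Ventures.LatticeQCDFlow.TrivializingMaps.GaugeCovariance
import HarnessLib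

/-!
# Zero modes of Lüscher's Laplacian are the constants — proof on the field manifold `SU(n)^E`

HONEST FRAMING: exact (Metropolis-corrected) sampling algorithms for lattice gauge theory; figures of merit are
autocorrelation/cost numbers at stated couplings and volumes; no continuum-physics claim.

Lüscher, CMP 293 (2010) 899, §4.2 (after eq. (4.8)): "the function `φ = 1` is the only zero mode" of
`𝓛_t = Δ + t ∂S·∂`; §4.3 (after eq. (4.15)): the recursion (4.12)–(4.13) therefore determines the actions
`S̃^{(k)}` "unambiguously up to an irrelevant additive constant". The file `HaarByPartsZeroModes` proved the
first half (`linkDeriv_eq_zero_of_linkLap_eq_const`: `Δφ = const` on `SU(n)^E` forces `∂^a_e φ = 0` on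
`SU(n)^E`). This file proves the second half — **vanishing link gradient on `SU(n)^E` forces `φ` to be
constant on `SU(n)^E`** (`apply_coeConfig_eq_of_linkDeriv_eq_zero`) — and hence the full statement
`apply_coeConfig_eq_of_linkLap_eq_const`. Mechanism (connectedness of `SU(n)^E`, made concrete): every
`g ∈ SU(n)` is an exponential `e^Y`, `Y ∈ 𝔰𝔲(n)` (tree: `SUNBakryEmery.exists_skew_traceless_exp_eq`,
diagonalisation), the link curve `s ↦ (e^{sY} U(e), U(e'))` stays on the manifold and has velocity
`∂_{e,Y} φ` there (`hasDerivAt_comp_linkCurve_at`), so `φ ∘ ι` is invariant under `U(e) ↦ g U(e)` one link at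
a time, and the links are finitely many. Also recorded (§1): manifold curves in `𝔰𝔲(n)` directions stay on
the manifold, so `∂_{e,Y} φ` and `Δφ` ON `SU(n)^E` depend only on `φ|_{SU(n)^E}` (no regularity needed) —
the input that makes `Δ` act on restricted functionals (used by the finite-dimensional solver of the
recursion, file `PoissonSolver`).

References: M. Lüscher, Trivializing maps, the Wilson flow and the HMC algorithm, CMP 293 (2010) 899
[Luscher2010Trivializing, arXiv:0907.5491], §4.2 eqs. (4.6)–(4.9), §4.3 eqs. (4.12)–(4.15), App. A (A.1)–(A.3);
T. Bröcker, T. tom Dieck, Representations of Compact Lie Groups, GTM 98 (1985), IV (3.1) (surjectivity of `exp`).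
-/

namespace Summit.Ventures.LatticeQCDFlow.TrivializingMaps

open MeasureTheory
open Literature.MathematicalPhysics.QuantumFieldTheory
open Literature.MathematicalPhysics.QuantumFieldTheory.Luscher2010
open scoped Matrix Matrix.Norms.Frobenius ContDiff

variable {d L n : ℕ}

/-! ## §1. Link curves in `𝔰𝔲(n)` directions stay on the field manifold -/

section ManifoldCurves

/-- **The link curve through `ι(U)` in an `𝔰𝔲(n)` direction stays on the manifold**: it is `ι` of the curve
`s ↦ (e^{sY} U(e), U(e'))` in `SU(n)^E`. [cite: Luscher2010Trivializing, §2.2 eq. (2.2), App. A eq. (A.3)] -/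
theorem linkCurve_coeConfig {Y : Matrix (Fin n) (Fin n) ℂ} (hY : Y ∈ suAlgebra n)
    (U : GaugeConfig d L (Matrix.specialUnitaryGroup (Fin n) ℂ)) (e : Edge d L) (s : ℝ) :
    Function.update (WilsonFlow.coeConfig U) e
        (NormedSpace.exp ((s : ℂ) • Y) * WilsonFlow.coeConfig U e) =
      WilsonFlow.coeConfig (Function.update U e
        (⟨NormedSpace.exp ((s : ℂ) • Y), exp_smul_mem_specialUnitaryGroup hY s⟩ * U e)) := by
  rw [coeConfig_update]
  rfl

/-- **Link derivatives on the manifold only see the restriction**: if `φ = ψ` on `SU(n)^E` then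
`∂_{e,Y} φ = ∂_{e,Y} ψ` on `SU(n)^E` for every `Y ∈ 𝔰𝔲(n)` (no regularity needed: the two one-variable
functions being differentiated coincide). [cite: Luscher2010Trivializing, §2.2 eq. (2.2)] -/
theorem linkDeriv_coeConfig_congr {φ ψ : AmbConfig d L n → ℝ}
    (h : ∀ U : GaugeConfig d L (Matrix.specialUnitaryGroup (Fin n) ℂ),
      φ (WilsonFlow.coeConfig U) = ψ (WilsonFlow.coeConfig U))
    (e : Edge d L) {Y : Matrix (Fin n) (Fin n) ℂ} (hY : Y ∈ suAlgebra n)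
    (U : GaugeConfig d L (Matrix.specialUnitaryGroup (Fin n) ℂ)) :
    linkDeriv e Y φ (WilsonFlow.coeConfig U) = linkDeriv e Y ψ (WilsonFlow.coeConfig U) := by
  unfold linkDeriv
  have hfun : (fun s : ℝ => φ (Function.update (WilsonFlow.coeConfig U) e
      (NormedSpace.exp ((s : ℂ) • Y) * WilsonFlow.coeConfig U e))) =
      fun s : ℝ => ψ (Function.update (WilsonFlow.coeConfig U) e
        (NormedSpace.exp ((s : ℂ) • Y) * WilsonFlow.coeConfig U e)) := by
    funext s
    rw [linkCurve_coeConfig hY]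
    exact h _
  rw [hfun]

/-- In particular a function vanishing on `SU(n)^E` has vanishing `𝔰𝔲(n)` link derivatives there. [folklore] -/
theorem linkDeriv_coeConfig_eq_zero_of_eq_zero {φ : AmbConfig d L n → ℝ}
    (h : ∀ U : GaugeConfig d L (Matrix.specialUnitaryGroup (Fin n) ℂ), φ (WilsonFlow.coeConfig U) = 0)
    (e : Edge d L) {Y : Matrix (Fin n) (Fin n) ℂ} (hY : Y ∈ suAlgebra n)
    (U : GaugeConfig d L (Matrix.specialUnitaryGroup (Fin n) ℂ)) :
    linkDeriv e Y φ (WilsonFlow.coeConfig U) = 0 := by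
  rw [linkDeriv_coeConfig_congr (ψ := fun _ => (0 : ℝ)) h e hY U]
  unfold linkDeriv
  exact deriv_const (0 : ℝ) (0 : ℝ)

variable [NeZero L]

/-- **`Δ` on the manifold only sees the restriction**: `φ = ψ` on `SU(n)^E` implies `Δφ = Δψ` on `SU(n)^E`
(apply the previous lemma twice: the first derivatives agree on the manifold, hence so do their link
derivatives). [cite: Luscher2010Trivializing, §4.2 eq. (4.6)] -/
theorem linkLap_coeConfig_congr (B : SuBasis n) {φ ψ : AmbConfig d L n → ℝ}
    (h : ∀ U : GaugeConfig d L (Matrix.specialUnitaryGroup (Fin n) ℂ),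
      φ (WilsonFlow.coeConfig U) = ψ (WilsonFlow.coeConfig U))
    (U : GaugeConfig d L (Matrix.specialUnitaryGroup (Fin n) ℂ)) :
    linkLap B φ (WilsonFlow.coeConfig U) = linkLap B ψ (WilsonFlow.coeConfig U) := by
  unfold linkLap
  refine congrArg Neg.neg (Finset.sum_congr rfl fun e _ => Finset.sum_congr rfl fun a _ => ?_)
  exact linkDeriv_coeConfig_congr (fun U' => linkDeriv_coeConfig_congr h e (B.mem a) U') e (B.mem a) U

/-- A function vanishing on `SU(n)^E` has vanishing Laplacian there. [folklore] -/
theorem linkLap_coeConfig_eq_zero_of_eq_zero (B : SuBasis n) {φ : AmbConfig d L n → ℝ}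
    (h : ∀ U : GaugeConfig d L (Matrix.specialUnitaryGroup (Fin n) ℂ), φ (WilsonFlow.coeConfig U) = 0)
    (U : GaugeConfig d L (Matrix.specialUnitaryGroup (Fin n) ℂ)) :
    linkLap B φ (WilsonFlow.coeConfig U) = 0 := by
  rw [linkLap_coeConfig_congr B (ψ := fun _ => (0 : ℝ)) h U]
  unfold linkLap
  have h0 : ∀ (e : Edge d L) (X : Matrix (Fin n) (Fin n) ℂ) (W : AmbConfig d L n),
      linkDeriv e X (fun _ : AmbConfig d L n => (0 : ℝ)) W = 0 := fun e X W => by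
    unfold linkDeriv; exact deriv_const (0 : ℝ) (0 : ℝ)
  have h0' : ∀ (e : Edge d L) (X : Matrix (Fin n) (Fin n) ℂ),
      linkDeriv e X (fun _ : AmbConfig d L n => (0 : ℝ)) = fun _ => 0 := fun e X => funext (h0 e X)
  simp [h0', h0]

/-- The `𝓥_S` term on the manifold only sees the restriction of the test function (for fixed `S`). [folklore] -/
theorem luscherV_coeConfig_congr (B : SuBasis n) (S : AmbConfig d L n → ℝ) {φ ψ : AmbConfig d L n → ℝ}
    (h : ∀ U : GaugeConfig d L (Matrix.specialUnitaryGroup (Fin n) ℂ),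
      φ (WilsonFlow.coeConfig U) = ψ (WilsonFlow.coeConfig U))
    (U : GaugeConfig d L (Matrix.specialUnitaryGroup (Fin n) ℂ)) :
    luscherV B S φ (WilsonFlow.coeConfig U) = luscherV B S ψ (WilsonFlow.coeConfig U) := by
  unfold luscherV
  exact Finset.sum_congr rfl fun e _ => Finset.sum_congr rfl fun a _ => by
    rw [linkDeriv_coeConfig_congr h e (B.mem a) U]

end ManifoldCurves

/-! ## §2. Linearity of `∂_{e,Y}` in the direction `Y` (for differentiable functionals) -/

section Direction

variable [NeZero L]

omit [NeZero L] in
/-- A tangent vector `δ_e · (∑ c_a T^a) W(e)` is the corresponding combination of the `δ_e · T^a W(e)`. [folklore] -/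
theorem pi_single_sum_smul_mul (B : SuBasis n) (c : B.ι → ℝ) (e : Edge d L) (W : AmbConfig d L n) :
    (Pi.single e ((∑ a, (c a : ℂ) • B.T a) * W e) : AmbConfig d L n) =
      ∑ a, c a • (Pi.single e (B.T a * W e) : AmbConfig d L n) := by
  funext e'
  simp only [Finset.sum_apply, Pi.smul_apply]
  by_cases h : e' = e
  · subst h
    simp only [Pi.single_eq_same, Finset.sum_mul, Matrix.smul_mul, Complex.coe_smul]
  · simp [Pi.single_eq_of_ne h]

/-- **`∂_{e,Y}` is linear in `Y ∈ 𝔰𝔲(n)`** at points of differentiability: with `Y = ∑ c_a T^a`,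
`∂_{e,Y} f = ∑ c_a ∂^a_e f` (eq. (A.3): `∂_{e,Y} f(W) = Df(W)[δ_e · Y W(e)]`).
[cite: Luscher2010Trivializing, App. A eq. (A.3)] -/
theorem linkDeriv_eq_sum_basis (B : SuBasis n) {f : AmbConfig d L n → ℝ} {W : AmbConfig d L n}
    (hf : DifferentiableAt ℝ f W) (e : Edge d L) (c : B.ι → ℝ) :
    linkDeriv e (∑ a, (c a : ℂ) • B.T a) f W = ∑ a, c a * linkDeriv e (B.T a) f W := by
  rw [linkDeriv_eq_fderiv hf, pi_single_sum_smul_mul, map_sum]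
  refine Finset.sum_congr rfl fun a _ => ?_
  rw [map_smul, linkDeriv_eq_fderiv hf, smul_eq_mul]

/-- If all basis link derivatives `∂^a_e φ` vanish on `SU(n)^E` (for a differentiable `φ`), then so does
`∂_{e,Y} φ` for every `Y ∈ 𝔰𝔲(n)`. [cite: Luscher2010Trivializing, App. A eqs. (A.1)–(A.3)] -/
theorem linkDeriv_coeConfig_eq_zero_of_basis (B : SuBasis n) {φ : AmbConfig d L n → ℝ}
    (hφ : Differentiable ℝ φ)
    (h : ∀ (e : Edge d L) (a : B.ι) (U : GaugeConfig d L (Matrix.specialUnitaryGroup (Fin n) ℂ)),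
      linkDeriv e (B.T a) φ (WilsonFlow.coeConfig U) = 0)
    (e : Edge d L) {Y : Matrix (Fin n) (Fin n) ℂ} (hY : Y ∈ suAlgebra n)
    (U : GaugeConfig d L (Matrix.specialUnitaryGroup (Fin n) ℂ)) :
    linkDeriv e Y φ (WilsonFlow.coeConfig U) = 0 := by
  obtain ⟨c, rfl⟩ := B.span Y hY
  rw [linkDeriv_eq_sum_basis B (hφ _) e c]
  exact Finset.sum_eq_zero fun a _ => by rw [h, mul_zero]

end Direction

/-! ## §3. Vanishing gradient on `SU(n)^E` forces constancy on `SU(n)^E` -/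

section Constancy

variable [NeZero L]

/-- **One link.** If `∂_{e,Y} φ = 0` on `SU(n)^E` for all `Y ∈ 𝔰𝔲(n)` (`φ` differentiable), then `φ ∘ ι` is
unchanged when the link variable `U(e)` is replaced by any `g ∈ SU(n)`: write `g U(e)⁻¹ = e^Y`
(`exp : 𝔰𝔲(n) ↠ SU(n)`), and note that `s ↦ φ(ι(e^{sY}U(e), …))` has derivative `∂_{e,Y}φ = 0` at every `s`.
[cite: Luscher2010Trivializing, §4.2 (zero modes of `Δ`); BrockerTomDieck1985, IV (3.1)] -/
theorem apply_update_eq_of_linkDeriv_eq_zero {φ : AmbConfig d L n → ℝ} (hφ : Differentiable ℝ φ)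
    (e : Edge d L)
    (h : ∀ Y ∈ suAlgebra n, ∀ U : GaugeConfig d L (Matrix.specialUnitaryGroup (Fin n) ℂ),
      linkDeriv e Y φ (WilsonFlow.coeConfig U) = 0)
    (U : GaugeConfig d L (Matrix.specialUnitaryGroup (Fin n) ℂ)) (g : Matrix.specialUnitaryGroup (Fin n) ℂ) :
    φ (WilsonFlow.coeConfig (Function.update U e g)) = φ (WilsonFlow.coeConfig U) := by
  rcases Nat.eq_zero_or_pos n with hn | hn
  · subst hn
    have hg : g = U e := Subsingleton.elim _ _
    rw [hg, Function.update_eq_self]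
  · obtain ⟨Y, hY1, hY2, hYexp⟩ := SUNBakryEmery.exists_skew_traceless_exp_eq hn.ne' (g * (U e)⁻¹)
    have hY : Y ∈ suAlgebra n := (mem_suAlgebra_iff Y).2 ⟨hY1, hY2⟩
    set γ : ℝ → ℝ := fun s => φ (Function.update (WilsonFlow.coeConfig U) e
      (NormedSpace.exp ((s : ℂ) • Y) * WilsonFlow.coeConfig U e)) with hγ
    have hder : ∀ σ : ℝ, HasDerivAt γ 0 σ := by
      intro σ
      have h1 := hasDerivAt_comp_linkCurve_at hφ (WilsonFlow.coeConfig U) e Y σ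
      rw [linkCurve_coeConfig hY U e σ, h Y hY] at h1
      exact h1
    have hconst := is_const_of_deriv_eq_zero (f := γ) (fun t => (hder t).differentiableAt)
      (fun t => (hder t).deriv) 1 0
    have hγ0 : γ 0 = φ (WilsonFlow.coeConfig U) := by
      simp only [hγ, linkCurve_zero]
    have hγ1 : γ 1 = φ (WilsonFlow.coeConfig (Function.update U e g)) := by
      simp only [hγ]
      rw [coeConfig_update]
      congr 2
      rw [Complex.ofReal_one, one_smul, hYexp, WilsonFlow.coeConfig_apply]
      exact congrArg Subtype.val (inv_mul_cancel_right g (U e))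
    rw [← hγ0, ← hγ1, hconst]

/-- **All links.** If `∂_{e,Y} φ = 0` on `SU(n)^E` for every link `e` and every `Y ∈ 𝔰𝔲(n)` (`φ`
differentiable), then `φ` is constant on `SU(n)^E`: `φ(ι U) = φ(ι 1)` (replace the link variables by `1` one
at a time). [cite: Luscher2010Trivializing, §4.2 (zero modes of `Δ`)] -/
theorem apply_coeConfig_eq_of_linkDeriv_eq_zero' {φ : AmbConfig d L n → ℝ} (hφ : Differentiable ℝ φ)
    (h : ∀ (e : Edge d L), ∀ Y ∈ suAlgebra n, ∀ U : GaugeConfig d L (Matrix.specialUnitaryGroup (Fin n) ℂ),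
      linkDeriv e Y φ (WilsonFlow.coeConfig U) = 0)
    (U : GaugeConfig d L (Matrix.specialUnitaryGroup (Fin n) ℂ)) :
    φ (WilsonFlow.coeConfig U) = φ (WilsonFlow.coeConfig fun _ => 1) := by
  -- induction on the set of links where `U` may differ from `1`
  suffices key : ∀ (s : Finset (Edge d L)) (V : GaugeConfig d L (Matrix.specialUnitaryGroup (Fin n) ℂ)),
      (∀ e, e ∉ s → V e = 1) → φ (WilsonFlow.coeConfig V) = φ (WilsonFlow.coeConfig fun _ => 1) from
    key Finset.univ U fun e he => absurd (Finset.mem_univ e) he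
  intro s
  induction s using Finset.induction with
  | empty =>
    intro V hV
    have : V = fun _ => 1 := funext fun e => hV e (Finset.notMem_empty e)
    rw [this]
  | insert e s hes ih =>
    intro V hV
    have h1 : φ (WilsonFlow.coeConfig (Function.update V e 1)) = φ (WilsonFlow.coeConfig V) :=
      apply_update_eq_of_linkDeriv_eq_zero hφ e (h e) V 1
    rw [← h1]
    refine ih _ fun e' he' => ?_
    by_cases hee : e' = e
    · subst hee; simp
    · rw [Function.update_of_ne hee]
      exact hV e' (by simp [hee, he'])

/-- **Vanishing basis gradient on `SU(n)^E` forces constancy on `SU(n)^E`** (basis-indexed form, for a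
differentiable ambient representative): if `∂^a_{x,μ} φ = 0` on `SU(n)^E` for all links and colour indices,
then `φ(ι U) = φ(ι 1)` for every field `U`. [cite: Luscher2010Trivializing, §4.2 (after eq. (4.8))] -/
theorem apply_coeConfig_eq_of_linkDeriv_eq_zero (B : SuBasis n) {φ : AmbConfig d L n → ℝ}
    (hφ : Differentiable ℝ φ)
    (h : ∀ (e : Edge d L) (a : B.ι) (U : GaugeConfig d L (Matrix.specialUnitaryGroup (Fin n) ℂ)),
      linkDeriv e (B.T a) φ (WilsonFlow.coeConfig U) = 0)
    (U : GaugeConfig d L (Matrix.specialUnitaryGroup (Fin n) ℂ)) :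
    φ (WilsonFlow.coeConfig U) = φ (WilsonFlow.coeConfig fun _ => 1) :=
  apply_coeConfig_eq_of_linkDeriv_eq_zero' hφ
    (fun e _ hY U' => linkDeriv_coeConfig_eq_zero_of_basis B hφ h e hY U') U

/-- **Lüscher §4.2: the constant is the only zero mode of `Δ` — full statement.** If `φ` is smooth and `Δφ`
is constant on the field manifold `SU(n)^E`, then the constant is `0` and `φ` is constant on `SU(n)^E`:
`φ(ι U) = φ(ι 1)` for all `U` (Green's identity, `HaarByPartsZeroModes`, gives `∂φ = 0` on `SU(n)^E`;
§3 gives constancy). Consequently (§4.3) each order `S̃^{(k)}` of the flow-action series is determined by the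
recursion up to an additive constant on `SU(n)^E`. [cite: Luscher2010Trivializing, §4.2 eqs. (4.8)–(4.9), §4.3] -/
theorem apply_coeConfig_eq_of_linkLap_eq_const (B : SuBasis n) {φ : AmbConfig d L n → ℝ}
    (hφ : ContDiff ℝ ∞ φ) {κ : ℝ}
    (hκ : ∀ U : GaugeConfig d L (Matrix.specialUnitaryGroup (Fin n) ℂ),
      linkLap B φ (WilsonFlow.coeConfig U) = κ) :
    κ = 0 ∧ ∀ U : GaugeConfig d L (Matrix.specialUnitaryGroup (Fin n) ℂ),
      φ (WilsonFlow.coeConfig U) = φ (WilsonFlow.coeConfig fun _ => 1) := by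
  obtain ⟨hκ0, hD⟩ := linkDeriv_eq_zero_of_linkLap_eq_const B hφ hκ
  exact ⟨hκ0, apply_coeConfig_eq_of_linkDeriv_eq_zero B (hφ.differentiable (by simp)) hD⟩

/-- Two smooth functionals with the same Laplacian on `SU(n)^E` up to a constant differ by a constant on
`SU(n)^E` (the uniqueness clause of §4.3 for one order of the recursion). [cite: Luscher2010Trivializing, §4.3] -/
theorem sub_apply_coeConfig_eq_of_linkLap_eq (B : SuBasis n) {φ ψ : AmbConfig d L n → ℝ}
    (hφ : ContDiff ℝ ∞ φ) (hψ : ContDiff ℝ ∞ ψ) {κ : ℝ}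
    (hκ : ∀ U : GaugeConfig d L (Matrix.specialUnitaryGroup (Fin n) ℂ),
      linkLap B φ (WilsonFlow.coeConfig U) = linkLap B ψ (WilsonFlow.coeConfig U) + κ)
    (U : GaugeConfig d L (Matrix.specialUnitaryGroup (Fin n) ℂ)) :
    φ (WilsonFlow.coeConfig U) - ψ (WilsonFlow.coeConfig U) =
      φ (WilsonFlow.coeConfig fun _ => 1) - ψ (WilsonFlow.coeConfig fun _ => 1) := by
  have hL : ∀ U' : GaugeConfig d L (Matrix.specialUnitaryGroup (Fin n) ℂ),
      linkLap B (fun W => φ W - ψ W) (WilsonFlow.coeConfig U') = κ := fun U' => by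
    rw [linkLap_sub_of_contDiff B hφ hψ, hκ U']; ring
  exact (apply_coeConfig_eq_of_linkLap_eq_const B (hφ.sub hψ) hL).2 U

end Constancy

end Summit.Ventures.LatticeQCDFlow.TrivializingMaps
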